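import Literature.MathematicalPhysics.KineticTheory.HardSphereCollisionFluxBackward
import Literature.MathematicalPhysics.KineticTheory.HardSphereCampbellAssembly
import Literature.Analysis.FluidPDE.HardSphereScattering
import HarnessLib

/-!
# A hit piece in pre-collision cylinder coordinates: kinematic tools

Topic `Literature/MathematicalPhysics/KineticTheory`. Pure kinematics behind the change of
variables to collision coordinates for one hit piece of the Gallagher–Saint-Raymond–Texier window
analysis (`Alexander.hitPiece`), for the special pair (last sphere, sphere `i`) of `s + 2` hard
spheres of diameter `ε` on `T^d` — the input of the discharge of `HardSphereCampbellFormula`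
(Cercignani–Illner–Pulvirenti 1994 App. 4.A, "`dx = ε^{d-1} |v·n| dσ dt`"):

* the dictionary between the contact insertion `contactInsert` of the Campbell formula and the
  loss / gain configurations of the BBGKY vocabulary (`campbell_contactInsert_appendParticle`,
  `campbell_collidePair_lossConfig`);
* the data `S_{-τ} (gainConfig Z' i ν v)` of the backward free flight of the incoming contact
  configuration: velocities, relative position in the chart (`campbell_backData_vel`,
  `campbell_backData_pos_sub`), and its hitting time `τ` (`campbell_pairHitTime_contact_sub_smul`);
* the chart membership of hit-piece data: a non-grazing pre-collisional relative datum lies in the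
  collision cylinder of its relative velocity (`campbell_mem_collisionCylRegion_of_billiardGood`).

## References

* [CIP1994] C. Cercignani, R. Illner, M. Pulvirenti, *The Mathematical Theory of Dilute Gases*,
  Applied Math. Sciences 106, Springer (1994), App. 4.A pp. 107–111.
* [GST2013] I. Gallagher, L. Saint-Raymond, B. Texier, *From Newton to Boltzmann: hard spheres
  and short-range potentials*, EMS (2013), proof of Prop. 4.1.1.
-/

open MeasureTheory Set Function Filter Metric
open scoped ENNReal NNReal RealInnerProductSpace

namespace Literature.MathematicalPhysics.KineticTheory

open Literature.Analysis.FluidPDE Literature.Analysis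

noncomputable section

variable {d : Type*} [Fintype d] {ε : ℝ}

/-! ### The contact insertion in the BBGKY vocabulary -/

/-- **Dictionary**: inserting the last sphere at contact with sphere `i` of an adjoined
configuration `(Z', x, v)` gives the loss configuration `lossConfig Z' i ω v` (the discarded
coordinate `x` disappears). [folklore] -/
theorem campbell_contactInsert_appendParticle (ε : ℝ) {s : ℕ} (i : Fin (s + 1)) (ω : EuclideanSpace ℝ d)
    (Z' : Config (s + 1) d (UnitAddTorus d)) (x : UnitAddTorus d) (v : EuclideanSpace ℝ d) :
    contactInsert ε (Fin.natAdd (s + 1) 0) (Fin.castAdd 1 i) ω (appendParticle Z' x v) =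
      lossConfig (Torus.geometry d) ε Z' i ω v := by
  funext j
  refine Fin.addCases (fun j => ?_) (fun j => ?_) j
  · rw [contactInsert_apply_of_ne ε _ ω _ (castAdd_ne_natAdd j), appendParticle_castAdd,
      lossConfig_apply_castAdd]
  · obtain rfl : j = 0 := Subsingleton.elim _ _
    rw [contactInsert_apply_self, appendParticle_castAdd, appendParticle_last, lossConfig_apply_last,
      Torus.geometry_translate]

/-- **The pre-collisional contact configuration**: for `0 < ε < 1/2` and a unit `ν`, the elastic
collision of the pair (last sphere, sphere `i`) turns the loss configuration into the gain
configuration (at contact distance `ε` the collision of `(j, i)` is that of `(i, j)`,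
`collidePair_comm`, and `outRep ∘ lossConfig = gainConfig`). [folklore] -/
theorem campbell_collidePair_lossConfig (hε : 0 < ε) (hε' : ε < 2⁻¹) {s : ℕ}
    (Z' : Config (s + 1) d (UnitAddTorus d)) (i : Fin (s + 1)) (ν : Metric.sphere (0 : EuclideanSpace ℝ d) 1)
    (v : EuclideanSpace ℝ d) :
    collidePair (Torus.geometry d) (Fin.natAdd (s + 1) 0) (Fin.castAdd 1 i)
        (lossConfig (Torus.geometry d) ε Z' i ν v) = gainConfig (Torus.geometry d) ε Z' i ν v := by
  have hG := Torus.isHardSphereRegular_geometry (d := d) hε'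
  have hne : (Fin.castAdd 1 i : Fin (s + 1 + 1)) ≠ Fin.natAdd (s + 1) 0 := castAdd_ne_natAdd i
  have hsep : ‖(Torus.geometry d).sepVec (lossConfig (Torus.geometry d) ε Z' i ν v (Fin.castAdd 1 i)).1
      (lossConfig (Torus.geometry d) ε Z' i ν v (Fin.natAdd (s + 1) 0)).1‖ ≤ ε := by
    rw [sepVec_lossConfig_partner hε hε' Z' i ν v, norm_neg, norm_smul, Real.norm_of_nonneg hε.le,
      norm_eq_of_mem_sphere ν, mul_one]
  rw [Geometry.IsHardSphereRegular.collidePair_comm hG hne hsep]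
  exact outRep_lossConfig_torus hε hε' Z' i ν v

/-- The collision of the special pair undoes itself: `collidePair (gainConfig) = lossConfig`. [folklore] -/
theorem campbell_collidePair_gainConfig (hε : 0 < ε) (hε' : ε < 2⁻¹) {s : ℕ}
    (Z' : Config (s + 1) d (UnitAddTorus d)) (i : Fin (s + 1)) (ν : Metric.sphere (0 : EuclideanSpace ℝ d) 1)
    (v : EuclideanSpace ℝ d) :
    collidePair (Torus.geometry d) (Fin.natAdd (s + 1) 0) (Fin.castAdd 1 i)
        (gainConfig (Torus.geometry d) ε Z' i ν v) = lossConfig (Torus.geometry d) ε Z' i ν v := by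
  have hne : (Fin.natAdd (s + 1) 0 : Fin (s + 1 + 1)) ≠ Fin.castAdd 1 i := (castAdd_ne_natAdd i).symm
  rw [← campbell_collidePair_lossConfig hε hε' Z' i ν v, collidePair_collidePair hne]

/-! ### The flux of the incoming velocities -/

/-- The incoming relative velocity has the opposite flux: `⟪v* - v_i*, ν⟫ = -⟪v - v_i, ν⟫`,
`(v_i*, v*) = collide ν (v_i, v)`. [folklore] -/
theorem campbell_inner_collide_sub (ν : Metric.sphere (0 : EuclideanSpace ℝ d) 1) (a v : EuclideanSpace ℝ d) :
    ⟪(collide ν (a, v)).2 - (collide ν (a, v)).1, (ν : EuclideanSpace ℝ d)⟫ =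
      -⟪v - a, (ν : EuclideanSpace ℝ d)⟫ := by
  have hω : ⟪(ν : EuclideanSpace ℝ d), (ν : EuclideanSpace ℝ d)⟫ = 1 := real_inner_self_sphere ν
  simp only [collide, inner_sub_left, inner_add_left, inner_smul_left, RCLike.conj_to_real, hω]
  ring

/-! ### The datum of the backward free flight of the incoming contact configuration -/

/-- The velocities of the last sphere and of sphere `i` in `S_{-τ} (gainConfig Z' i ν v)` are the
incoming velocities `(v*, v_i*)`. [folklore] -/
theorem campbell_backData_vel {s : ℕ} (i : Fin (s + 1)) (ε : ℝ) (Z' : Config (s + 1) d (UnitAddTorus d))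
    (ν : Metric.sphere (0 : EuclideanSpace ℝ d) 1) (v : EuclideanSpace ℝ d) (τ : ℝ) :
    (freeFlight (Torus.geometry d) (-τ) (gainConfig (Torus.geometry d) ε Z' i ν v) (Fin.natAdd (s + 1) 0)).2 =
        (collide ν ((Z' i).2, v)).2 ∧
      (freeFlight (Torus.geometry d) (-τ) (gainConfig (Torus.geometry d) ε Z' i ν v) (Fin.castAdd 1 i)).2 =
        (collide ν ((Z' i).2, v)).1 := by
  constructor
  · rw [freeFlight_apply, gainConfig_apply_last, reflectVel_eq_collide]
  · rw [freeFlight_apply, gainConfig_apply_castAdd_snd, if_pos rfl, reflectVel_eq_collide]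

/-- The relative position (as a point of the torus) of the last sphere and sphere `i` in
`S_{-τ} (gainConfig Z' i ν v)` is the projection of `ε ν - τ (v* - v_i*)`. [folklore] -/
theorem campbell_backData_pos_sub {s : ℕ} (i : Fin (s + 1)) (ε : ℝ) (Z' : Config (s + 1) d (UnitAddTorus d))
    (ν : Metric.sphere (0 : EuclideanSpace ℝ d) 1) (v : EuclideanSpace ℝ d) (τ : ℝ) :
    (freeFlight (Torus.geometry d) (-τ) (gainConfig (Torus.geometry d) ε Z' i ν v) (Fin.natAdd (s + 1) 0)).1 -
        (freeFlight (Torus.geometry d) (-τ) (gainConfig (Torus.geometry d) ε Z' i ν v) (Fin.castAdd 1 i)).1 =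
      FunctionSpaces.Torus.proj (ε • (ν : EuclideanSpace ℝ d) -
        τ • ((collide ν ((Z' i).2, v)).2 - (collide ν ((Z' i).2, v)).1)) := by
  have hps : ∀ a b : EuclideanSpace ℝ d,
      FunctionSpaces.Torus.proj (a - b) = FunctionSpaces.Torus.proj a - FunctionSpaces.Torus.proj b :=
    fun _ _ => rfl
  have hpa : ∀ a b : EuclideanSpace ℝ d,
      FunctionSpaces.Torus.proj (a + b) = FunctionSpaces.Torus.proj a + FunctionSpaces.Torus.proj b :=
    fun _ _ => rfl
  simp only [freeFlight_apply, gainConfig_apply_last, gainConfig_apply_castAdd, Function.update_self,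
    reflectVel_eq_collide, Torus.geometry_translate]
  rw [show ε • (ν : EuclideanSpace ℝ d) - τ • ((collide ν ((Z' i).2, v)).2 - (collide ν ((Z' i).2, v)).1) =
      ε • (ν : EuclideanSpace ℝ d) + (-τ) • (collide ν ((Z' i).2, v)).2 - (-τ) • (collide ν ((Z' i).2, v)).1 by
        module, hps, hpa]
  abel

/-- The minimal-image separation of the last sphere and sphere `i` in `S_{-τ} (gainConfig Z' i ν v)`
is `ε ν - τ (v* - v_i*)` as soon as this vector lies in the cube `(-1/2, 1/2]^d`. [folklore] -/
theorem campbell_backData_sepVec {s : ℕ} (i : Fin (s + 1)) (ε : ℝ) (Z' : Config (s + 1) d (UnitAddTorus d))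
    (ν : Metric.sphere (0 : EuclideanSpace ℝ d) 1) (v : EuclideanSpace ℝ d) (τ : ℝ)
    (h : ε • (ν : EuclideanSpace ℝ d) - τ • ((collide ν ((Z' i).2, v)).2 - (collide ν ((Z' i).2, v)).1) ∈
      Torus.symCube d) :
    (Torus.geometry d).sepVec
        (freeFlight (Torus.geometry d) (-τ) (gainConfig (Torus.geometry d) ε Z' i ν v) (Fin.natAdd (s + 1) 0)).1
        (freeFlight (Torus.geometry d) (-τ) (gainConfig (Torus.geometry d) ε Z' i ν v) (Fin.castAdd 1 i)).1 =
      ε • (ν : EuclideanSpace ℝ d) - τ • ((collide ν ((Z' i).2, v)).2 - (collide ν ((Z' i).2, v)).1) := by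
  rw [Torus.geometry_sepVec, campbell_backData_pos_sub]
  exact Alexander.reprSym_proj_of_mem_symCube h

/-! ### Hitting times from a contact point -/

/-- **The hitting time of the backward flight from an incoming contact**: if `‖n‖ = ε` and
`⟪n, g⟫ < 0` then the relative datum `(n - τ g, g)` reaches distance `ε` at time `τ`
(`pairHitTime` is equivariant under free flight and vanishes at contact). [folklore] -/
theorem campbell_pairHitTime_contact_sub_smul (hε : 0 ≤ ε) {n g : EuclideanSpace ℝ d} (hn : ‖n‖ = ε)
    (hin : ⟪n, g⟫ < 0) (τ : ℝ) : pairHitTime ε (n - τ • g) g = τ := by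
  have hg : g ≠ 0 := by
    rintro rfl
    simp at hin
  have hPH : PairHits ε n g := by
    refine ⟨hin, ?_⟩
    unfold pairDisc
    rw [hn, sub_self, mul_zero, sub_zero]
    positivity
  have h0 : pairHitTime ε n g = 0 := (pairHitTime_eq_zero_iff hε hPH).2 hn
  rw [sub_eq_add_neg, ← neg_smul, pairHitTime_add_smul ε n g hg, h0]
  ring

/-- The backward flight from an incoming contact is a hitting datum: `PairHits ε (n - τ g) g`
for `τ ≥ 0`. [folklore] -/
theorem campbell_pairHits_contact_sub_smul {n g : EuclideanSpace ℝ d} (hn : ‖n‖ = ε)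
    (hin : ⟪n, g⟫ < 0) {τ : ℝ} (hτ : 0 ≤ τ) : PairHits ε (n - τ • g) g := by
  refine ⟨?_, ?_⟩
  · rw [inner_sub_left, real_inner_smul_left, real_inner_self_eq_norm_sq]
    nlinarith [sq_nonneg ‖g‖]
  · unfold pairDisc
    rw [inner_sub_left, real_inner_smul_left, real_inner_self_eq_norm_sq]
    have h1 : ‖n - τ • g‖ ^ 2 = ‖n‖ ^ 2 - 2 * τ * ⟪n, g⟫ + τ ^ 2 * ‖g‖ ^ 2 := by
      rw [norm_sub_sq_real, real_inner_smul_right, norm_smul, mul_pow, Real.norm_eq_abs, sq_abs]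
      ring
    rw [h1, hn]
    nlinarith [sq_nonneg ‖g‖, sq_nonneg (⟪n, g⟫ - τ * ‖g‖ ^ 2)]

/-! ### Chart membership of hit-piece data -/

/-- **A non-grazing pre-collisional datum lies in the collision cylinder of its relative
velocity**: if `(q, g) ∈ billiardGood ε` (`ε < ‖q‖`, approaching, positive discriminant) then
`q = ε ω + τ₀ (-g)` with `τ₀ = pairHitTime ε q g > 0`, `ω = n/ε` the unit hit direction, and
`⟪-g, ω⟫ > 0`; i.e. `q ∈ collisionCylRegion ε (-g)`. [folklore] -/
theorem campbell_mem_collisionCylRegion_of_billiardGood (hε : 0 < ε) {q g : EuclideanSpace ℝ d}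
    (h : ((q, g) : EuclideanSpace ℝ d × EuclideanSpace ℝ d) ∈ billiardGood ε) :
    q ∈ collisionCylRegion ε (-g) := by
  have hPH : PairHits ε q g := PairHits.of_mem_billiardGood h
  have hτpos : 0 < pairHitTime ε q g := pairHitTime_pos hε.le h.1 hPH
  have hn : ‖hitPoint ε (q, g)‖ = ε := norm_hitPoint hε.le h
  have hng : ⟪hitPoint ε (q, g), g⟫ < 0 := inner_hitPoint_neg h
  have hω : ‖ε⁻¹ • hitPoint ε (q, g)‖ = 1 := by
    rw [norm_smul, norm_inv, Real.norm_of_nonneg hε.le, hn, inv_mul_cancel₀ hε.ne']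
  refine ⟨pairHitTime ε q g • (ε⁻¹ • hitPoint ε (q, g)), ?_, ?_⟩
  · show 0 < ⟪-g, pairHitTime ε q g • (ε⁻¹ • hitPoint ε (q, g))⟫
    rw [real_inner_smul_right, real_inner_smul_right, inner_neg_left, real_inner_comm]
    have h1 : 0 < -⟪hitPoint ε (q, g), g⟫ := neg_pos.2 hng
    have h2 : 0 < ε⁻¹ * -⟪hitPoint ε (q, g), g⟫ := mul_pos (inv_pos.2 hε) h1
    exact mul_pos hτpos h2
  · rw [collisionCylMap_smul_unit ε (-g) hω hτpos, smul_smul, mul_inv_cancel₀ hε.ne', one_smul, smul_neg]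
    show q + pairHitTime ε q g • g + -(pairHitTime ε q g • g) = q
    abel

/-- **The chart coordinates of a flipped chart configuration.** For `r` in the cube, the
minimal-image separation of the last sphere and sphere `i` of
`flipVel (appendParticle W' (x'_i + proj r) w)` is `r`, and their relative velocity is
`-(w - v'_i)`. [folklore] -/
theorem campbell_flipChart_relData {s : ℕ} (i : Fin (s + 1)) (W' : Config (s + 1) d (UnitAddTorus d))
    (w r : EuclideanSpace ℝ d) (hr : r ∈ Torus.symCube d) :
    (Torus.geometry d).sepVec
          (flipVel (appendParticle W' ((W' i).1 + FunctionSpaces.Torus.proj r) w) (Fin.natAdd (s + 1) 0)).1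
          (flipVel (appendParticle W' ((W' i).1 + FunctionSpaces.Torus.proj r) w) (Fin.castAdd 1 i)).1 = r ∧
      (flipVel (appendParticle W' ((W' i).1 + FunctionSpaces.Torus.proj r) w) (Fin.natAdd (s + 1) 0)).2 -
          (flipVel (appendParticle W' ((W' i).1 + FunctionSpaces.Torus.proj r) w) (Fin.castAdd 1 i)).2 =
        -(w - (W' i).2) := by
  constructor
  · simp only [flipVel_apply, appendParticle_last, appendParticle_castAdd, Torus.geometry_sepVec,
      add_sub_cancel_left]
    exact Alexander.reprSym_proj_of_mem_symCube hr
  · simp only [flipVel_apply, appendParticle_last, appendParticle_castAdd]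
    abel

/-- **Chart support of hit-piece data**: if the flipped chart configuration
`flipVel (appendParticle W' (x'_i + proj r) w)`, `r ∈ (-1/2, 1/2]^d`, lies in the hit piece of the
pair (last sphere, sphere `i`) with interaction length `r₀`, then `r` lies in the closed ball of
radius `ε + r₀` and in the collision cylinder of `w - v'_i`. [folklore] -/
theorem campbell_chart_of_mem_hitPiece (hε : 0 < ε) {s : ℕ} (i : Fin (s + 1)) {r₀ δ : ℝ}
    (W' : Config (s + 1) d (UnitAddTorus d)) (w r : EuclideanSpace ℝ d) (hr : r ∈ Torus.symCube d)
    (hmem : flipVel (appendParticle W' ((W' i).1 + FunctionSpaces.Torus.proj r) w) ∈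
      Alexander.hitPiece (s + 1 + 1) ε r₀ δ (Fin.natAdd (s + 1) 0) (Fin.castAdd 1 i)) :
    r ∈ closedBall (0 : EuclideanSpace ℝ d) (ε + r₀) ∩ collisionCylRegion ε (w - (W' i).2) := by
  obtain ⟨hq, hw⟩ := campbell_flipChart_relData i W' w r hr
  obtain ⟨-, hnorm, hgood, -⟩ := hmem
  rw [hq] at hnorm
  rw [hq, hw] at hgood
  refine ⟨?_, ?_⟩
  · rwa [mem_closedBall, dist_zero_right]
  · have h := campbell_mem_collisionCylRegion_of_billiardGood hε hgood
    rwa [neg_neg] at h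

end

end Literature.MathematicalPhysics.KineticTheory
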